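import Summits.CriticalPhenomena.PercolationContinuityZ3.Theorems.PercNearOneGluingNoHeavyLowerTailSahiCombTriWCommonBottom
import Summits.CriticalPhenomena.PercolationContinuityZ3.Theorems.PercNearOneGluingNoHeavyLowerTailSahiCombTriWAntiNestedKernelProof

/-!
# `TRI_W(2) ≥ 0` on the HALF-CHAIN stratum with `P ∩ G{b} ⊆ F univ` (`G{a} ⊆ G{b}`; the test points of the large `G`-middle inside the top of `F`) — an explicit five-up-set certificate

Support file of the one-cut programme (crux `NoHeavyLowerTail`, stmt-CriticalPhenomena-4575; cell `prim-masterthm`, seat P5 gen 28;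
memo `FROM-prim-masterthm-p5-g28-HALFCHAIN-CERTIFICATES.md`).  Target `FiveUpSet.TriWIneq` (`…SahiCombTriWGeneral`), OPEN for index cubes of
dimension `a ≥ 2`; recommended sub-target of the lane: the half-chain stratum `FiveUpSet.HalfChainMidIneq` (`…TriWHalfChainMid`, P5 gen 27:
`G{a} ⊆ G{b}`, `F` an arbitrary diamond).  At `a = 2` the pair reduction `LatticeFiveUpSet.triW_nonneg_of_pair_nonneg` reduces `TriWIneq` to
`0 ≤ triWOne c P F₀ F₁ G₀ G₁ + triWOne c P Fp Fq Gp Gq` for two diamonds of up-sets `F₀ ⊆ Fp, Fq ⊆ F₁`, `G₀ ⊆ Gp, Gq ⊆ G₁`.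

* **`FiveUpSet.inner_pair_le_of_halfChain_testMidInFTop`** / **`FiveUpSet.triW_nonneg_of_halfChain_testMidInFTop`** — `Gp ⊆ Gq` and `P ∩ Gq ⊆ F₁` ⟹ the pair
  sum is `≥ 0`; hence `0 ≤ triW P F G` for monotone families over a two-atom index cube with `G{a} ⊆ G{b}` and `P ∩ G{b} ⊆ F univ`
  (`F ∅ ≠ ∅` and incomparable `F`-middles allowed).  This is the most general side condition of this shape found: it contains the strata of
  `…TriWHalfChainTestInFTop` (`P ⊆ F univ`), `…TriWHalfChainMidInFTop` (`G{b} ⊆ F univ`) and `…TriWHalfChainTopGe` (`G univ ⊆ F univ`).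
  CERTIFICATE (multiplier 1; five five-up-set instances `fiveUpSetIneq_holds` with arguments in the lattice generated by the nine sets and `P`:
  `(P; F₀⊆F₁; G₀⊆G₁)`, `(P∩Fp; Fp⊆univ; ∅⊆Gq)`, `(Fp; ∅⊆P∩F₁; Fp∩Gp⊆Gp)`, `(univ; P∩F₀⊆Fq; P∩G₀⊆G₁)`, `(P; ∅⊆Fq; Gp⊆Gq)`;
  remainder non-negative on every antipodal pair `{w, wᶜ}` — `sum_nonneg_of_compl_pair`, kernel `decide` over the `6⁴` diamond positions).
  Found by EXACT LP column generation (C pricer over all five-up-set / Kleitman atoms with intersection arguments + alternating search over all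
  type up-sets; P5 gen 28 `work/py/cg3.py`), verified beforehand on 4·10⁵ random genuine configurations.  The same LP for the WHOLE half-chain
  stratum is infeasible over this atom family already on its sub-stratum `G ∅ = G{a} = ∅` (fooling value `1/7`).
HONEST LABEL: one new unconditional stratum of `TriWIneq` at `a = 2`; `TriWIneq` and `HalfChainMidIneq` remain OPEN. [this work]
-/

namespace Summit.CriticalPhenomena.PercolationContinuityZ3.Theorems

namespace FiveUpSet

open Finset LatticeFiveUpSet

variable {γ : Type} [DecidableEq γ] [Fintype γ]

set_option synthInstance.maxHeartbeats 400000 in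
set_option synthInstance.maxSize 4096 in
set_option maxHeartbeats 1600000 in
/-- **`TRI_W(2) ≥ 0` on the HALF-CHAIN stratum `G{a} ⊆ G{b}` with P ∩ G{b} ⊆ F univ (test points of the large G-middle lie in the top of F; contains the strata P ⊆ F univ, G{b} ⊆ F univ, G univ ⊆ F univ of the companion files), pair form** (explicit certificate: 5 five-up-set instance(s), multiplier `1`,
remainder non-negative on every antipodal pair; found by exact LP column generation, P5 gen 28). [this work] -/
theorem inner_pair_le_of_halfChain_testMidInFTop (P F₀ Fp Fq F₁ G₀ Gp Gq G₁ : Finset (Finset γ)) (hP : IsUpperSet (P : Set (Finset γ)))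
    (hF₀ : IsUpperSet (F₀ : Set (Finset γ))) (hFp : IsUpperSet (Fp : Set (Finset γ))) (hFq : IsUpperSet (Fq : Set (Finset γ)))
    (hF₁ : IsUpperSet (F₁ : Set (Finset γ))) (hG₀ : IsUpperSet (G₀ : Set (Finset γ))) (hGp : IsUpperSet (Gp : Set (Finset γ)))
    (hGq : IsUpperSet (Gq : Set (Finset γ))) (hG₁ : IsUpperSet (G₁ : Set (Finset γ)))
    (hF0p : F₀ ⊆ Fp) (hF0q : F₀ ⊆ Fq) (hFp1 : Fp ⊆ F₁) (hFq1 : Fq ⊆ F₁)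
    (hG0p : G₀ ⊆ Gp) (hG0q : G₀ ⊆ Gq) (hGp1 : Gp ⊆ G₁) (hGq1 : Gq ⊆ G₁) (hGpq : Gp ⊆ Gq) (hPGF : P ∩ Gq ⊆ F₁) :
    0 ≤ triWOne (complEquiv γ) P F₀ F₁ G₀ G₁ + triWOne (complEquiv γ) P Fp Fq Gp Gq := by
  rw [triWOne_expand, triWOne_expand]
  have hW : IsUpperSet ((univ : Finset (Finset γ)) : Set (Finset γ)) := by rw [coe_univ]; exact isUpperSet_univ
  have hE : IsUpperSet ((∅ : Finset (Finset γ)) : Set (Finset γ)) := isUpperSet_empty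
  have hPFp : IsUpperSet ((P ∩ Fp : Finset (Finset γ)) : Set (Finset γ)) := by rw [coe_inter]; exact hP.inter hFp
  have hPF0 : IsUpperSet ((P ∩ F₀ : Finset (Finset γ)) : Set (Finset γ)) := by rw [coe_inter]; exact hP.inter hF₀
  have hPG0 : IsUpperSet ((P ∩ G₀ : Finset (Finset γ)) : Set (Finset γ)) := by rw [coe_inter]; exact hP.inter hG₀
  have hFpGp : IsUpperSet ((Fp ∩ Gp : Finset (Finset γ)) : Set (Finset γ)) := by rw [coe_inter]; exact hFp.inter hGp
  have hPF1 : IsUpperSet ((P ∩ F₁ : Finset (Finset γ)) : Set (Finset γ)) := by rw [coe_inter]; exact hP.inter hF₁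
  have h1 := fiveUpSetIneq_holds γ P F₀ F₁ G₀ G₁ hP hF₀ hF₁ hG₀ hG₁ (hF0p.trans hFp1) (hG0p.trans hGp1)
  have h1' : 0 ≤ (((P ∩ F₁ ∩ G₁).card : ℤ) + ((P ∩ F₀ ∩ G₀).card : ℤ) - ((P ∩ F₁ ∩ refl G₀).card : ℤ) - ((P ∩ refl F₀ ∩ G₁).card : ℤ) - ((P ∩ refl (F₁ \ F₀) ∩ refl (G₁ \ G₀)).card : ℤ)) := by
    have := h1; omega
  have h2 := fiveUpSetIneq_holds γ (P ∩ Fp) Fp univ ∅ Gq hPFp hFp hW hE hGq (subset_univ _) (empty_subset _)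
  have h2' : 0 ≤ ((((P ∩ Fp) ∩ univ ∩ Gq).card : ℤ) + (((P ∩ Fp) ∩ Fp ∩ ∅).card : ℤ) - (((P ∩ Fp) ∩ univ ∩ refl ∅).card : ℤ) - (((P ∩ Fp) ∩ refl Fp ∩ Gq).card : ℤ) - (((P ∩ Fp) ∩ refl (univ \ Fp) ∩ refl (Gq \ ∅)).card : ℤ)) := by
    have := h2; omega
  have h3 := fiveUpSetIneq_holds γ Fp ∅ (P ∩ F₁) (Fp ∩ Gp) Gp hFp hE hPF1 hFpGp hGp (empty_subset _) inter_subset_right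
  have h3' : 0 ≤ (((Fp ∩ (P ∩ F₁) ∩ Gp).card : ℤ) + ((Fp ∩ ∅ ∩ (Fp ∩ Gp)).card : ℤ) - ((Fp ∩ (P ∩ F₁) ∩ refl (Fp ∩ Gp)).card : ℤ) - ((Fp ∩ refl ∅ ∩ Gp).card : ℤ) - ((Fp ∩ refl ((P ∩ F₁) \ ∅) ∩ refl (Gp \ (Fp ∩ Gp))).card : ℤ)) := by
    have := h3; omega
  have h4 := fiveUpSetIneq_holds γ univ (P ∩ F₀) Fq (P ∩ G₀) G₁ hW hPF0 hFq hPG0 hG₁ (inter_subset_right.trans hF0q) (inter_subset_right.trans (hG0p.trans hGp1))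
  have h4' : 0 ≤ (((univ ∩ Fq ∩ G₁).card : ℤ) + ((univ ∩ (P ∩ F₀) ∩ (P ∩ G₀)).card : ℤ) - ((univ ∩ Fq ∩ refl (P ∩ G₀)).card : ℤ) - ((univ ∩ refl (P ∩ F₀) ∩ G₁).card : ℤ) - ((univ ∩ refl (Fq \ (P ∩ F₀)) ∩ refl (G₁ \ (P ∩ G₀))).card : ℤ)) := by
    have := h4; omega
  have h5 := fiveUpSetIneq_holds γ P ∅ Fq Gp Gq hP hE hFq hGp hGq (empty_subset _) hGpq
  have h5' : 0 ≤ (((P ∩ Fq ∩ Gq).card : ℤ) + ((P ∩ ∅ ∩ Gp).card : ℤ) - ((P ∩ Fq ∩ refl Gp).card : ℤ) - ((P ∩ refl ∅ ∩ Gq).card : ℤ) - ((P ∩ refl (Fq \ ∅) ∩ refl (Gq \ Gp)).card : ℤ)) := by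
    have := h5; omega
  have hR : 0 ≤ 1 * ((2 * (((P ∩ F₀ ∩ G₀).card : ℤ) + ((P ∩ F₁ ∩ G₁).card : ℤ)) - (((P ∩ refl F₀ ∩ G₁).card : ℤ) + ((P ∩ refl F₁ ∩ G₀).card : ℤ)) - (((P ∩ F₀ ∩ refl G₁).card : ℤ) + ((P ∩ F₁ ∩ refl G₀).card : ℤ)) - (((P ∩ refl F₀ ∩ refl G₀).card : ℤ) + ((P ∩ refl F₁ ∩ refl G₁).card : ℤ)) + (((P ∩ refl F₀ ∩ refl G₁).card : ℤ) + ((P ∩ refl F₁ ∩ refl G₀).card : ℤ))) + (2 * (((P ∩ Fp ∩ Gp).card : ℤ) + ((P ∩ Fq ∩ Gq).card : ℤ)) - (((P ∩ refl Fp ∩ Gq).card : ℤ) + ((P ∩ refl Fq ∩ Gp).card : ℤ)) - (((P ∩ Fp ∩ refl Gq).card : ℤ) + ((P ∩ Fq ∩ refl Gp).card : ℤ)) - (((P ∩ refl Fp ∩ refl Gp).card : ℤ) + ((P ∩ refl Fq ∩ refl Gq).card : ℤ)) + (((P ∩ refl Fp ∩ refl Gq).card : ℤ) + ((P ∩ refl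 Fq ∩ refl Gp).card : ℤ)))) - (1 * (((P ∩ F₁ ∩ G₁).card : ℤ) + ((P ∩ F₀ ∩ G₀).card : ℤ) - ((P ∩ F₁ ∩ refl G₀).card : ℤ) - ((P ∩ refl F₀ ∩ G₁).card : ℤ) - ((P ∩ refl (F₁ \ F₀) ∩ refl (G₁ \ G₀)).card : ℤ)) + 1 * ((((P ∩ Fp) ∩ univ ∩ Gq).card : ℤ) + (((P ∩ Fp) ∩ Fp ∩ ∅).card : ℤ) - (((P ∩ Fp) ∩ univ ∩ refl ∅).card : ℤ) - (((P ∩ Fp) ∩ refl Fp ∩ Gq).card : ℤ) - (((P ∩ Fp) ∩ refl (univ \ Fp) ∩ refl (Gq \ ∅)).card : ℤ)) + 1 * (((Fp ∩ (P ∩ F₁) ∩ Gp).card : ℤ) + ((Fp ∩ ∅ ∩ (Fp ∩ Gp)).card : ℤ) - ((Fp ∩ (P ∩ F₁) ∩ refl (Fp ∩ Gp)).card : ℤ) - ((Fp ∩ refl ∅ ∩ Gp).card : ℤ) - ((Fp ∩ refl ((P ∩ F₁) \ ∅) ∩ refl (Gp \ (Fp ∩ Gp))).card : ℤ)) + 1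 * (((univ ∩ Fq ∩ G₁).card : ℤ) + ((univ ∩ (P ∩ F₀) ∩ (P ∩ G₀)).card : ℤ) - ((univ ∩ Fq ∩ refl (P ∩ G₀)).card : ℤ) - ((univ ∩ refl (P ∩ F₀) ∩ G₁).card : ℤ) - ((univ ∩ refl (Fq \ (P ∩ F₀)) ∩ refl (G₁ \ (P ∩ G₀))).card : ℤ)) + 1 * (((P ∩ Fq ∩ Gq).card : ℤ) + ((P ∩ ∅ ∩ Gp).card : ℤ) - ((P ∩ Fq ∩ refl Gp).card : ℤ) - ((P ∩ refl ∅ ∩ Gq).card : ℤ) - ((P ∩ refl (Fq \ ∅) ∩ refl (Gq \ Gp)).card : ℤ))) := by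
    simp only [card_eq_univ_sum]
    simp only [mem_inter, mem_refl, mem_sdiff, Finset.notMem_empty, Finset.mem_univ]
    simp only [mul_add, mul_sub]
    simp only [Finset.mul_sum, ← Finset.sum_add_distrib, ← Finset.sum_sub_distrib]
    refine sum_nonneg_of_compl_pair (fun w => ?_)
    simp only [compl_compl]
    obtain ⟨s₁, a0, ap, aq, a1⟩ := diamond_pos hF0p hF0q hFp1 hFq1 w
    obtain ⟨s₂, b0, bp, bq, b1⟩ := diamond_pos hG0p hG0q hGp1 hGq1 w
    obtain ⟨s₃, c0, cp, cq, c1⟩ := diamond_pos hF0p hF0q hFp1 hFq1 wᶜ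
    obtain ⟨s₄, d0, dp, dq, d1⟩ := diamond_pos hG0p hG0q hGp1 hGq1 wᶜ
    have gpq : (s₂ = 2 ∨ s₂ = 4 ∨ s₂ = 5) → (s₂ = 3 ∨ s₂ = 4 ∨ s₂ = 5) := fun h => bq.mp (hGpq (bp.mpr h))
    have gpq' : (s₄ = 2 ∨ s₄ = 4 ∨ s₄ = 5) → (s₄ = 3 ∨ s₄ = 4 ∨ s₄ = 5) := fun h => dq.mp (hGpq (dp.mpr h))
    have pf : w ∈ P → (s₂ = 3 ∨ s₂ = 4 ∨ s₂ = 5) → s₁ ≠ 0 := fun h h2 => a1.mp (hPGF (mem_inter.mpr ⟨h, bq.mpr h2⟩))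
    have qf : wᶜ ∈ P → (s₄ = 3 ∨ s₄ = 4 ∨ s₄ = 5) → s₃ ≠ 0 := fun h h2 => c1.mp (hPGF (mem_inter.mpr ⟨h, dq.mpr h2⟩))
    simp only [a0, ap, aq, a1, b0, bp, bq, b1, c0, cp, cq, c1, d0, dp, dq, d1]
    clear a0 ap aq a1 b0 bp bq b1 c0 cp cq c1 d0 dp dq d1
    by_cases hp : w ∈ P
    · have pf' := pf hp
      by_cases hq : wᶜ ∈ P
      · have qf' := qf hq; clear pf qf; simp only [hp, hq]; revert s₁ s₂ s₃ s₄; decide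
      · clear pf qf; simp only [hp, hq]; revert s₁ s₂ s₃ s₄; decide
    · by_cases hq : wᶜ ∈ P
      · have qf' := qf hq; clear pf qf; simp only [hp, hq]; revert s₁ s₂ s₃ s₄; decide
      · clear pf qf; simp only [hp, hq]; revert s₁ s₂ s₃ s₄; decide
  linarith [hR, h1', h2', h3', h4', h5']

/-- **STRATUM of `TRI_W(2) ≥ 0` (unconditional): `G` a HALF-CHAIN (`G{a} ⊆ G{b}`) and P ∩ G{b} ⊆ F univ (test points of the large G-middle lie in the top of F; contains the strata P ⊆ F univ, G{b} ⊆ F univ, G univ ⊆ F univ of the companion files); `F` ARBITRARY.**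
Index cube with two atoms `a ≠ b`, up-set `P`, monotone families `F, G` of up-sets of a finite cube: `0 ≤ triW P F G`.
Pair reduction `LatticeFiveUpSet.triW_nonneg_of_pair_nonneg` + `inner_pair_le_of_halfChain_testMidInFTop`. [this work] -/
theorem triW_nonneg_of_halfChain_testMidInFTop {β : Type} [DecidableEq β] [Fintype β] {a b : β} (hab : a ≠ b) (hu : (univ : Finset β) = {a, b})
    (P : Finset (Finset γ)) (F G : Finset β → Finset (Finset γ))
    (hP : IsUpperSet (P : Set (Finset γ))) (hF : ∀ x, IsUpperSet (F x : Set (Finset γ))) (hG : ∀ x, IsUpperSet (G x : Set (Finset γ)))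
    (hFm : Monotone F) (hGm : Monotone G) (hGab : G {a} ⊆ G {b}) (hPGF : P ∩ G {b} ⊆ F univ) : 0 ≤ triW P F G := by
  refine LatticeFiveUpSet.triW_nonneg_of_pair_nonneg hab hu P F G ?_
  exact inner_pair_le_of_halfChain_testMidInFTop P (F ∅) (F {a}) (F {b}) (F univ) (G ∅) (G {a}) (G {b}) (G univ) hP (hF ∅) (hF {a}) (hF {b}) (hF univ)
    (hG ∅) (hG {a}) (hG {b}) (hG univ) (hFm (empty_subset _)) (hFm (empty_subset _)) (hFm (subset_univ _)) (hFm (subset_univ _))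
    (hGm (empty_subset _)) (hGm (empty_subset _)) (hGm (subset_univ _)) (hGm (subset_univ _)) hGab hPGF

end FiveUpSet

end Summit.CriticalPhenomena.PercolationContinuityZ3.Theorems
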